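import Literature.NumberTheory.Multiplicative.Balazard1990.TopRange
import HarnessLib

/-!
# Balazard (1990), p. 27, Question 2 for `σ(x,k)`: the local law of `Ω` is NOT log-concave in `k` —
# `k ↦ σ(x,k)` is log-concave iff `x ∈ E`, `|E| = 77`, `max E = 224`

Source: M. Balazard, *Quelques exemples de suites unimodales en théorie des nombres*, Séminaire de Théorie des
Nombres de Bordeaux (2) **2** (1990) 13–30, doi:10.5802/jtnb.17 (open access) [Balazard1990], p. 27 Question 2
(with p. 14: log-concavity, p. 20: `σ(x,k)`).  PRIMARY READ from the vendored page-image excerpt of the H21 archive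
(`archive/2001-boxes/tp/literature/sources/balazard-1990-jtnb2-unimodales/EXCERPTS-prove-tp-omega-count-log-concavity.md`,
§BZ9 = p. 27, §BZ5 = p. 14, §BZ6 = p. 20).

The published question (verbatim, p. 27, closing §4 = Balazard's proof of Erdős's unimodality conjecture, Théorème E:
for `x` large, `π(x,k)`, `ρ(x,k)`, `σ(x,k)` are unimodal in `k`).  "Terminons ce paragraphe par une liste de
questions.  1. Des expériences sur ordinateur semblent indiquer que π(x,k), ρ(x,k) et σ(x,k) sont unimodales dès que
x ≥ 1 : est-ce vrai ?  2. Ces trois suites sont-elles log-concaves ?" — with (p. 20) `σ(x,k) := Σ_{n ≤ x, Ω(n) = k} 1`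
and (p. 14) "La suite de nombres réels positifs ou nuls (u_k)_{k∈I} est dite logarithmiquement concave … si
u_k² ≥ u_{k+1}.u_{k−1} pour tout k ∈ I tel que k ± 1 ∈ I, et si le support de u (l'ensemble des k pour lesquels
u_k ≠ 0) est un intervalle de Z."  CATEGORY: a published QUESTION answered in the negative — not a refuted claim.
Only the sequence `σ` (prime factors WITH multiplicity) is treated; Question 2 for `π(x,k)` and `ρ(x,k)` remains open
(the 2001 study reports both log-concave for all `x ≤ 10⁷`; nothing about them is claimed here).

What is proved here (kernel-checked, standard axioms; no `native_decide`):
* NINE BLOCKS `exists_violation_of_ge` (2001 programme, Proposition 4 / Table 2): `[2^12, 2^13) ∋ u = ⌊x/2^{K−12}⌋`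
  is cut at `4608, 5184, 5632, 5888, 6272, 6912, 7168, 7776`; on block `r` with index `i_r ∈ {1,2,2,3,3,1,1,2,2}` the
  kernel-evaluated values `NW_…` of `Literature.NumberTheory.Multiplicative.Balazard1990.TopRange` give `N_i(u)² ≤ U_r² < L⁻_r L⁺_r ≤ N_{i−1}(u) N_{i+1}(u)`, i.e.
  `σ(x,K−i)² < σ(x,K−i+1) σ(x,K−i−1)`: a violation at `k = K − i_r ∈ {K−3, K−2, K−1}` for EVERY `x ≥ 2^12`
  (`not_isLogConcave_sigma_of_ge`, and the shifted form);
* `isLogConcave_sigma_iff_mem_E : 1 ≤ x → (IsLogConcave (sigma x) ↔ x ∈ E)` with the explicit 77-element `E` of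
  `Literature.NumberTheory.Multiplicative.Balazard1990.Basic` (this is Theorem 1 of the 2001-programme paper), `isLogConcave_sigma_224` (so `225` is sharp),
  `not_isLogConcave_sigma_of_ge_225`, and the ANSWER to reading (b): `question2SigmaEventually_false :
  ¬ Question2SigmaEventually`; the same three statements for the sequence indexed from `k = 1`.  (Reading (a) is
  answered in `Literature.NumberTheory.Multiplicative.Balazard1990.FiniteRange` by `x = 16`.)
To our knowledge Question 2 had not been answered in print (search record: bundle INVENTORY.md §G B13); an easy
negative instance such as `x = 16` may well have been noticed informally.

Modules: `Literature.NumberTheory.Multiplicative.Balazard1990.Compute` (kernel-computable data: trial-division `Ω`, the row pass, the breakpoint table),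
`KernelFin` / `KernelTab` (the `decide +kernel` evaluations), `Basic` (§§1–3: `sigma`, `IsLogConcave`, `E`, the four
readings `Question2Sigma…`, `omegaC = Ω`, elementary facts), `FiniteRange` (§§4–5: `x < 2^12`, the witness `x = 16`,
`question2Sigma_false`), `TopRange` (§§6–7: `σ(x,K−i)` as a step function, the 84 breakpoints), `Blocks` (§§8–9:
the nine blocks, `isLogConcave_sigma_iff_mem_E`, `question2SigmaEventually_false`).

Provenance: refutations bundle `papers/_cross/refutations` (H21 seat pub-refute-2, 2026-08-18), package module
`Refutations.Balazard1990 (§§8–9)`, moved into the tree under the Lean-in-tree rule (human 2026-08-18).  The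
classification `E` and the proof structure are the 2001 H21 programme's (archive route `tp/omega-count-log-concavity`,
Theorem 1, "review: upheld"); the bundle's exact Python certificate `numerics/balazard1990/check_balazard_sigma_Q2.py`
checks the same two legs independently.
-/

open scoped ArithmeticFunction.Omega

namespace Literature.NumberTheory.Multiplicative.Balazard1990

/-! ## 8. Nine blocks: a violation at `k ∈ {K-3, K-2, K-1}` for every `x ≥ 2^12` -/

/-- One block of Table 2: if `a ≤ u < b` (`u = ⌊x/2^{K-12}⌋`), `N_i(b-1)² < N_{i-1}(a) N_{i+1}(a)`, then by
monotonicity `σ(x,K-i)² < σ(x,K-i+1) σ(x,K-i-1)`, a violation at `k = K - i`. [folklore] -/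
theorem violation_of_block {x K : ℕ} (i a b U Lm Lp : ℕ) (hK : 12 ≤ K) (hx2 : x < 2 ^ (K + 1))
    (hi1 : 1 ≤ i) (hi3 : i ≤ 3) (ha : a ≤ x / 2 ^ (K - 12)) (hb : x / 2 ^ (K - 12) < b)
    (hU : NW i (b - 1) = U) (hLm : NW (i - 1) a = Lm) (hLp : NW (i + 1) a = Lp) (hlt : U * U < Lm * Lp) :
    ∃ k : ℕ, 8 ≤ k ∧ sigma x (k + 1) ^ 2 < sigma x k * sigma x (k + 2) := by
  set u := x / 2 ^ (K - 12) with hu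
  have hu2 : u < 8192 := by
    rw [hu, Nat.div_lt_iff_lt_mul (Nat.two_pow_pos _)]
    calc x < 2 ^ (K + 1) := hx2
      _ = 8192 * 2 ^ (K - 12) := by
          rw [show (8192 : ℕ) = 2 ^ 13 by norm_num, ← pow_add]; congr 1; omega
  refine ⟨K - i - 1, by omega, ?_⟩
  have e0 : sigma x (K - i - 1 + 1) = NW i u := by
    rw [show K - i - 1 + 1 = K - i by omega, sigma_top hK hx2 (by omega), Ncount_eq_NW (by omega) hu2]
  have e1 : sigma x (K - i - 1) = NW (i + 1) u := by
    rw [show K - i - 1 = K - (i + 1) by omega, sigma_top hK hx2 (by omega), Ncount_eq_NW (by omega) hu2]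
  have e2 : sigma x (K - i - 1 + 2) = NW (i - 1) u := by
    rw [show K - i - 1 + 2 = K - (i - 1) by omega, sigma_top hK hx2 (by omega), Ncount_eq_NW (by omega) hu2]
  rw [e0, e1, e2]
  have m0 : NW i u ≤ U := hU ▸ NW_mono i (show u ≤ b - 1 by omega)
  have m1 : Lp ≤ NW (i + 1) u := hLp ▸ NW_mono (i + 1) ha
  have m2 : Lm ≤ NW (i - 1) u := hLm ▸ NW_mono (i - 1) ha
  calc NW i u ^ 2 ≤ U * U := by rw [sq]; exact Nat.mul_le_mul m0 m0
    _ < Lm * Lp := hlt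
    _ ≤ NW (i - 1) u * NW (i + 1) u := Nat.mul_le_mul m2 m1
    _ = NW (i + 1) u * NW (i - 1) u := mul_comm _ _

/-- **Infinite range** (2001 paper, Theorem 1(i)): for every `x ≥ 2^12` there is a violation
`σ(x,k+1)² < σ(x,k) σ(x,k+2)` with `k + 1 ∈ {K-3, K-2, K-1}`, `K = ⌊log₂ x⌋` (so `k ≥ 8`). [folklore] -/
theorem exists_violation_of_ge {x : ℕ} (hx : 4096 ≤ x) :
    ∃ k : ℕ, 8 ≤ k ∧ sigma x (k + 1) ^ 2 < sigma x k * sigma x (k + 2) := by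
  set K := Nat.log 2 x with hK_def
  have hx0 : x ≠ 0 := by omega
  have hx1 : 2 ^ K ≤ x := Nat.pow_log_le_self 2 hx0
  have hx2 : x < 2 ^ (K + 1) := Nat.lt_pow_succ_log_self (by norm_num) x
  have hK : 12 ≤ K := by
    by_contra h
    have : 2 ^ (K + 1) ≤ 2 ^ 12 := Nat.pow_le_pow_right (by norm_num) (by omega)
    omega
  set u := x / 2 ^ (K - 12) with hu
  have hpos := Nat.two_pow_pos (K - 12)
  have hu1 : 4096 ≤ u := by
    rw [hu, Nat.le_div_iff_mul_le hpos]
    calc 4096 * 2 ^ (K - 12) = 2 ^ K := by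
          rw [show (4096 : ℕ) = 2 ^ 12 by norm_num, ← pow_add]; congr 1; omega
      _ ≤ x := hx1
  have hu2 : u < 8192 := by
    rw [hu, Nat.div_lt_iff_lt_mul hpos]
    calc x < 2 ^ (K + 1) := hx2
      _ = 8192 * 2 ^ (K - 12) := by
          rw [show (8192 : ℕ) = 2 ^ 13 by norm_num, ← pow_add]; congr 1; omega
  rcases Nat.lt_or_ge u 4608 with h1 | h1
  · exact violation_of_block 1 4096 4608 2 1 7 hK hx2 (by norm_num) (by norm_num) (by omega) (by omega)
      NW_1_4607 NW_0_4096 NW_2_4096 (by norm_num)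
  rcases Nat.lt_or_ge u 5184 with h2 | h2
  · exact violation_of_block 2 4608 5184 7 3 19 hK hx2 (by norm_num) (by norm_num) (by omega) (by omega)
      NW_2_5183 NW_1_4608 NW_3_4608 (by norm_num)
  rcases Nat.lt_or_ge u 5632 with h3 | h3
  · exact violation_of_block 2 5184 5632 9 4 22 hK hx2 (by norm_num) (by norm_num) (by omega) (by omega)
      NW_2_5631 NW_1_5184 NW_3_5184 (by norm_num)
  rcases Nat.lt_or_ge u 5888 with h4 | h4
  · exact violation_of_block 3 5632 5888 23 10 57 hK hx2 (by norm_num) (by norm_num) (by omega) (by omega)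
      NW_3_5887 NW_2_5632 NW_4_5632 (by norm_num)
  rcases Nat.lt_or_ge u 6272 with h5 | h5
  · exact violation_of_block 3 5888 6272 25 11 58 hK hx2 (by norm_num) (by norm_num) (by omega) (by omega)
      NW_3_6271 NW_2_5888 NW_4_5888 (by norm_num)
  rcases Nat.lt_or_ge u 6912 with h6 | h6
  · exact violation_of_block 1 6272 6912 4 2 11 hK hx2 (by norm_num) (by norm_num) (by omega) (by omega)
      NW_1_6911 NW_0_6272 NW_2_6272 (by norm_num)
  rcases Nat.lt_or_ge u 7168 with h7 | h7
  · exact violation_of_block 1 6912 7168 5 2 13 hK hx2 (by norm_num) (by norm_num) (by omega) (by omega)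
      NW_1_7167 NW_0_6912 NW_2_6912 (by norm_num)
  rcases Nat.lt_or_ge u 7776 with h8 | h8
  · exact violation_of_block 2 7168 7776 13 6 31 hK hx2 (by norm_num) (by norm_num) (by omega) (by omega)
      NW_2_7775 NW_1_7168 NW_3_7168 (by norm_num)
  · exact violation_of_block 2 7776 8192 15 7 35 hK hx2 (by norm_num) (by norm_num) (by omega) (by omega)
      NW_2_8191 NW_1_7776 NW_3_7776 (by norm_num)

/-- Auxiliary lemma: `{x : ℕ} (hx : 4096 ≤ x) : ¬ IsLogConcave (sigma x)`. [folklore] -/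
theorem not_isLogConcave_sigma_of_ge {x : ℕ} (hx : 4096 ≤ x) : ¬ IsLogConcave (sigma x) := by
  intro h
  obtain ⟨k, -, hk⟩ := exists_violation_of_ge hx
  have := h.1 k
  omega

/-- Auxiliary lemma: `{x : ℕ} (hx : 4096 ≤ x) : ¬ IsLogConcave (fun k => sigma x (k + 1))`. [folklore] -/
theorem not_isLogConcave_sigma_shift_of_ge {x : ℕ} (hx : 4096 ≤ x) :
    ¬ IsLogConcave (fun k => sigma x (k + 1)) := by
  intro h
  obtain ⟨k, hk8, hk⟩ := exists_violation_of_ge hx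
  obtain ⟨j, rfl⟩ : ∃ j, k = j + 1 := ⟨k - 1, by omega⟩
  have h2 : sigma x (j + 1) * sigma x (j + 3) ≤ sigma x (j + 2) ^ 2 := h.1 j
  have hk' : sigma x (j + 2) ^ 2 < sigma x (j + 1) * sigma x (j + 3) := hk
  omega

/-! ## 9. Main theorems -/

/-- **Theorem** (2001 programme, Theorem 1; Balazard's Question 2 for `σ`). For every `x ≥ 1`, the sequence
`k ↦ σ(x,k)` (`k ≥ 0`) is log-concave if and only if `x ∈ E`, a set of `77` integers with largest element
`224`. [folklore] -/
theorem isLogConcave_sigma_iff_mem_E {x : ℕ} (h1 : 1 ≤ x) : IsLogConcave (sigma x) ↔ x ∈ E := by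
  rcases Nat.lt_or_ge x 4096 with hx | hx
  · exact isLogConcave_sigma_iff_mem_E_of_lt h1 hx
  · refine ⟨fun h => absurd h (not_isLogConcave_sigma_of_ge hx), fun h => ?_⟩
    have := max_E x h
    omega

/-- The same for the sequence indexed from `k = 1`. [folklore] -/
theorem isLogConcave_sigma_shift_iff_mem_E {x : ℕ} (h1 : 1 ≤ x) :
    IsLogConcave (fun k => sigma x (k + 1)) ↔ x ∈ E := by
  rcases Nat.lt_or_ge x 4096 with hx | hx
  · exact isLogConcave_sigma_shift_iff_mem_E_of_lt h1 hx
  · refine ⟨fun h => absurd h (not_isLogConcave_sigma_shift_of_ge hx), fun h => ?_⟩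
    have := max_E x h
    omega

/-- In particular `k ↦ σ(x,k)` is not log-concave for any `x ≥ 225`. [folklore] -/
theorem not_isLogConcave_sigma_of_ge_225 {x : ℕ} (hx : 225 ≤ x) : ¬ IsLogConcave (sigma x) := by
  rw [isLogConcave_sigma_iff_mem_E (by omega)]
  intro h
  have := max_E x h
  omega

/-- The shifted sequence `k ↦ σ(x,k+1)` is not log-concave for any `x ≥ 225` either. [folklore] -/
theorem not_isLogConcave_sigma_shift_of_ge_225 {x : ℕ} (hx : 225 ≤ x) :
    ¬ IsLogConcave (fun k => sigma x (k + 1)) := by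
  rw [isLogConcave_sigma_shift_iff_mem_E (by omega)]
  intro h
  have := max_E x h
  omega

/-- `x = 224` IS log-concave (the largest such `x`), so `225` is sharp. [folklore] -/
theorem isLogConcave_sigma_224 : IsLogConcave (sigma 224) :=
  (isLogConcave_sigma_iff_mem_E (by norm_num)).mpr mem_E_224

/-- Answer to Question 2 for `σ`, reading (b) (every sufficiently large `x`): **no**. [folklore] -/
theorem question2SigmaEventually_false : ¬ Question2SigmaEventually := by
  rintro ⟨x₀, h⟩
  exact not_isLogConcave_sigma_of_ge_225 (show 225 ≤ max x₀ 225 from le_max_right _ _)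
    (h _ (le_max_left _ _))

/-- Auxiliary lemma: `: ¬ Question2SigmaEventually₁`. [folklore] -/
theorem question2SigmaEventually₁_false : ¬ Question2SigmaEventually₁ := by
  rintro ⟨x₀, h⟩
  exact not_isLogConcave_sigma_shift_of_ge_225 (show 225 ≤ max x₀ 225 from le_max_right _ _)
    (h _ (le_max_left _ _))

end Literature.NumberTheory.Multiplicative.Balazard1990
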